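import Summits.HodgeConjecture.HodgeConjecture.Theorems.F0P2oD7alphaMemDockOfRowsSignedW1      -- ★ p849502 ROAD W (e) (sign-blind kit currency): brings the W1 node ★ p849450, the DOCKᵀ-W1 junction ★ p849452, ★ generic MEM `F0P2oD7alphaMemOfT5`, B1 sign transport
import Summits.HodgeConjecture.HodgeConjecture.Theorems.F0P2oD7alphaShapeOfRecordSCDSigned     -- ★ p848493 `shape_xiPacketFamilyOfRecordSCD_of_packageTestSigned` (SIGNED SHAPE at the SCD record; kit-free)
import Summits.HodgeConjecture.HodgeConjecture.Theorems.F0P3RelParityOfRecordW                -- ★ `F0P3KitOfRecordW.lawsV8_kitFamilyOfRecordW_of_rows` (v8 family laws of a W-kit family from its fourteen rows)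
import Summits.HodgeConjecture.HodgeConjecture.Theorems.F0P3KitFamilyOfRecordW                -- ★ `F0P3KitOfRecordW.FrameDataW`, `kitFamilyOfRecordW`, `isPinned_kitFamilyOfRecordW`
import HarnessLib

/-!
# Crux `H413`, programme P2 — (D7α) «D7αᵀ AT RUNG 0, DRY TERM, SIGNED, W1» **IN THE W-KIT CURRENCY OF THE CLOSER OF RECORD**: the W1 node `StubD7αMemDockPerMeasureTW1` AT THE ROWS OF A
# W-KIT FAMILY (`FrameDataW` ∕ `kitFamilyOfRecordW`) WHOSE ξ-PACKETS ARE THE SCD RECORD AT THE SIGNED-PACKAGE DATUM — the W twins of ★ `mem_packFin_of_rows`, ★ p849502, ★ p849516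

Cell `hodgecm-mathlib` (D-0151), FLOOR 0, crux item H413 = `stmt-HodgeConjecture-24833`, route of record `HCCMUnconditional`; programme P2, fallback road PKΠ
`Cruxes/H413/Lines/F0_P2PKPiRung4.lean` v1.16 «DOCK-TW1» (28efbef3f47613fb; `stub_D7αMemDockμTW1 : …F0P2oD7alphaMemDockStatementW1.StubD7αMemDockPerMeasureTW1`).  Seat F0P2-p06 (g15)
on the LHref-S (g2) BOX «LH10 #1 — DAY-X PRE-JUNCTION» 2026-09-02T06:32:49Z (scratch `F0/P3c/LHref-S/g2/JX_DayX_LH10_twinW.LHrefSg2.lean` d5289f7d6f4d2ea2, rc 0, TRIO — this file is its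
report-first form; proof bytes are the referee՚s script twins of the ★ producers).  Helper file: THEOREMS ONLY (no definition, no named fact, no instance, no notation, no `sorry`);
`--supports stmt-HodgeConjecture-24833 --as helper`; Lines-free; ADDITIVE (no ★ file edited).  HONEST LABEL: HC_CM is proved only modulo the printed citations (2 remaining named inputs
hLiu418 24832, h413 24833) until rung 0 closes; this file discharges none of them — its hypotheses are the closer՚s fourteen ROWS and, per (frame, μ), the rung-0 exports named below.

WHY (the referee՚s three findings, kernel-confirmed against the closer AGG `Cruxes/H413/Lines/F0_U3LettersRung1.lean` ED. 40 206759753a6e41ec).  (N1) ★ p849502 ∕ ★ p849516 take the record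
data `𝔇 : ∀ frame, F0P3KitOfRecord.FrameData …` (SIGN-BLIND currency), but the closer՚s family of record since AGG ED. 38 «PK-ε» is `F0U3LettersRung1.frameDataOfRung0 : ∀ frame,
F0P3KitOfRecordW.FrameDataW …` (one more field `wXi`; `kitOfRecordW … wXi c`: `N := N₀ + [wXi ξ = −1]`, `sgnG := wXi · c`).  (N2) the closer՚s fourteen rows `F0U3LettersRung1.rows_of_rung0`
are stated on `kitFamilyOfRecordW frameDataOfRung0`, and the two sign-BEARING rows (`SpecPkg S₀`, `UnitaryPacket S₀`) admit no `Iff.rfl` transport to any `kitFamilyOfRecord 𝔇`.  (N3)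
independent of W: row #9 of the producers՚ `h` read `(kitFamilyOfRecord 𝔇 …).Routing` (the v6 PROJECTION, unguarded) while the closer՚s row #9 is
`F0P3InnerFormClassificationV8.ClassificationKit.Routing (kitFamilyOfRecordW …)` (v8 GUARDED `IsCot P → KcTrivial P → …`, KitD ED. 5 RULING (V54)(3)); 13∕14 rows byte-identical after the
W-substitution.  THE REPAIR IS CHEAP because `h` is consumed ONLY by MEM, and MEM needs only `KitFamily.Laws` (v8) + `IsPinned`, both ★ for the W family
(`lawsV8_kitFamilyOfRecordW_of_rows`, `isPinned_kitFamilyOfRecordW`); the node `StubD7αMemDockPerMeasureTW1` (★ p849450) and the SIGNED SHAPE (★ p848493) are kit-free.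

WHAT.  §1 `mem_packFin_of_rowsW 𝔇W h` — MEM at the rows of a W-kit family (W twin of ★ `F0P2oD7alphaMemDockOfRows.mem_packFin_of_rows`; `h` = the `h` TEXT of ★
`lawsV8_kitFamilyOfRecordW_of_rows` token for token, i.e. the closer՚s `rows_of_rung0` type with `frameDataOfRung0` abstracted to `𝔇W`).  §1 `stubD7αMemDockPerMeasureTW1_of_rowsSignedW 𝔇W h
hrecSW1` — W twin of ★ p849502 (the (H₄ᵀˢ) packet-identity conjunct reads `(kitFamilyOfRecordW 𝔇W …).packFin ξ v = …`; everything else byte-identical).  §1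
`stubD7αMemDockPerMeasureTW1_of_rowsSCDSignedW 𝔇W h hrecSCDSW1` — W twin of ★ p849516 (the (Ξ) conjunct reads `(kitFamilyOfRecordW 𝔇W …).packFin = xiPacketFamilyOfRecordSCD … keys
(hSCD_of_cmCharIdentityPackageTestSigned … hQS)`).  All three: `--axioms` = [propext, Classical.choice, Quot.sound].

DAY-X TERM OF RECORD (re-pointed; replaces the prose of ★ p849516 docblock l.18–20 and of PKΠ v1.16 `stub_D7αMemDockμTW1` :859–865 — the Lines docstring edit, if any, is the registrar՚s):
`stub_D7αMemDockμTW1 := F0P2oD7alphaMemDockOfRowsSCDSignedW1W.stubD7αMemDockPerMeasureTW1_of_rowsSCDSignedW F0U3LettersRung1.frameDataOfRung0 F0U3LettersRung1.rows_of_rung0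
(fun L ι H T hT hdef h2 μω hμu hμω μ _ => ⟨𝔨.Δ, mH, mG, νG, νH, μZ, isHaar_μZ, isHaar_νG, keys, hQS, rfl, hex, fun e₁ dV hdV hdV0 g hg ξ => ‹jx-shaped term over LH10
`F0P3cDbTPaydown.Db_T_paidW1 L ι H T hT hdef h2 … Δ mH mG νG νH μω hμu hμω μ hΔ hcan hQS hex e₁ dV hdV hdV0 g hg ξ`, LHref-S `JX_DayX_LH10_pos` c82a758ca3cd4ab0›⟩)` — the first two
arguments TYPE at the closer of record (LHref-S `JX_DayX_LH10_twinW….out` l.3–34; my HOME cert `F0/P2/F0P2-p06/g15/CERT-W1W-DayX-typing.byimport.F0P2p06g15.lean`); the five closer-side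
obligations are in the closer՚s own vocabulary (`W.isHaar_νH ∕ isRightInv_νH ∕ isHaar_νG ∕ isRightInv_νG` AGG :305–308, `𝔨.Δ = finExplicitCollection …` + `hQ : CMCharIdentityPackageTestSigned …`
KitRung0 :287–292, canonicity Defs :740–741); the road-S fallback twin is `…_of_rowsSignedW` + `Db_T_paid` + `…_toW1`.

References: [Rogawski1990] §12.2 (2) pp. 173–174; §13.1 Prop. 13.1.3 (d), Prop. 13.1.4 p. 199; §13.3 pp. 201–202; §4.9 Prop. 4.9.1 (a) p. 55; §14.6 p. 242.
[GelbartRogawski1991] Lem. 5.1.2 p. 466; Thm. 5.1.1 p. 465.  [Liu2021] Def. 4.11, Prop. 4.13.  [LanglandsShelstad1987] §1.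
-/

set_option autoImplicit false
-- the mandated namespace repeats `HodgeConjecture.HodgeConjecture`, as in every `Theorems/*.lean` of this sub-problem
set_option linter.dupNamespace false

noncomputable section

open NumberField IsDedekindDomain MeasureTheory
open scoped Matrix ComplexOrder

namespace Summit.HodgeConjecture.HodgeConjecture.Cruxes.H413.F0P2oD7alphaMemDockOfRowsSCDSignedW1W

open Literature.NumberTheory.Rogawski1990 Literature.NumberTheory.GaloisRepresentations
open Literature.NumberTheory.Automorphic Literature.NumberTheory.Automorphic.UnitaryGroup
open Literature.NumberTheory.Automorphic.UnitaryGroup.CotangentForms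
open Literature.RepresentationTheory.BorelWallach2000 Literature.RepresentationTheory.KonnoKonno2007
open Summit.HodgeConjecture.HodgeConjecture.Cruxes.H413.F0P3InnerFormClassificationV6 (Gp Places)
open Summit.HodgeConjecture.HodgeConjecture.Cruxes.H413.F0P3KitOfRecordW (FrameDataW kitFamilyOfRecordW isPinned_kitFamilyOfRecordW lawsV8_kitFamilyOfRecordW_of_rows)
open Summit.HodgeConjecture.HodgeConjecture.Cruxes.H413.F0P3XiArchPacketOfRecord (JInfNoDegOne DsInfNoDegOne)

/-! ## §1 The W1 node at the rows of a W-kit family of record (MEM, SIGNED rows, SIGNED rows at the SCD record) -/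

section PerMeasureSCDSW1W

variable
  (𝔇W : ∀ (L : Type) [Field L] [NumberField L] [IsCMField L] (ι : L →+* ℂ) (H : Matrix (Fin 3) (Fin 3) L) (T : GL (Fin 3) ℂ)
    (hT : (T : Matrix (Fin 3) (Fin 3) ℂ)ᴴ * H.map ι * (T : Matrix (Fin 3) (Fin 3) ℂ) = Literature.Geometry.ComplexHyperbolic.BallModel.J),
    (∀ τ' : L →+* ℂ, InfinitePlace.mk τ' ≠ InfinitePlace.mk ι → (H.map τ').PosDef) →
    2 ≤ Module.finrank ℚ ↥(maximalRealSubfield L) →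
    ∀ (μ : Measure (Gp L H).automorphicQuotient) [(Gp L H).IsAutomorphicMeasure μ] (μω : HeckeCharacter L) (_hμu : μω.IsUnitary),
    (∀ x : Literature.NumberTheory.GaloisRepresentations.ideleGroup ↥(maximalRealSubfield L),
      μω (AdeleRing.ideleBaseChange (↥(maximalRealSubfield L)) L x) = quadraticHeckeCharCM L x) → FrameDataW L H ι T hT μ)
  (h : ∀ (L : Type) [Field L] [NumberField L] [IsCMField L] (ι : L →+* ℂ) (H : Matrix (Fin 3) (Fin 3) L) (T : GL (Fin 3) ℂ)
    (hT : (T : Matrix (Fin 3) (Fin 3) ℂ)ᴴ * H.map ι * (T : Matrix (Fin 3) (Fin 3) ℂ) = Literature.Geometry.ComplexHyperbolic.BallModel.J)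
    (hdef : ∀ τ' : L →+* ℂ, InfinitePlace.mk τ' ≠ InfinitePlace.mk ι → (H.map τ').PosDef) (h2 : 2 ≤ Module.finrank ℚ ↥(maximalRealSubfield L))
    (μ : Measure (Gp L H).automorphicQuotient) [(Gp L H).IsAutomorphicMeasure μ] (μω : HeckeCharacter L) (hμu : μω.IsUnitary)
    (hμω : ∀ x : Literature.NumberTheory.GaloisRepresentations.ideleGroup ↥(maximalRealSubfield L),
      μω (AdeleRing.ideleBaseChange (↥(maximalRealSubfield L)) L x) = quadraticHeckeCharCM L x),
    ∃ S₀ : Finset (Places L),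
    F0P3InnerFormClassificationV8.ClassificationKit.SpecPkg (kitFamilyOfRecordW 𝔇W L ι H T hT hdef h2 μ μω hμu hμω) S₀ ∧
    (kitFamilyOfRecordW 𝔇W L ι H T hT hdef h2 μ μω hμu hμω).TraceIdentity ∧
    F0P3InnerFormClassificationV8.ClassificationKit.FactorisationCls (kitFamilyOfRecordW 𝔇W L ι H T hT hdef h2 μ μω hμu hμω) S₀ ∧
    (kitFamilyOfRecordW 𝔇W L ι H T hT hdef h2 μ μω hμu hμω).SpectralSideGp ∧
    F0P3InnerFormClassificationV8.ClassificationKit.HatBounded (kitFamilyOfRecordW 𝔇W L ι H T hT hdef h2 μ μω hμu hμω) S₀ ∧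
    F0P3InnerFormClassificationV8.ClassificationKit.UnrStarAlgebra (kitFamilyOfRecordW 𝔇W L ι H T hT hdef h2 μ μω hμu hμω) S₀ ∧
    (kitFamilyOfRecordW 𝔇W L ι H T hT hdef h2 μ μω hμu hμω).LinIndepS ∧
    F0P3InnerFormClassificationV8.ClassificationKit.UnitaryPacket (kitFamilyOfRecordW 𝔇W L ι H T hT hdef h2 μ μω hμu hμω) S₀ ∧
    -- row #9 KEYED to the closer՚s text (KitD ED. 5, RULING (V54)(3)): the v8 GUARDED routing (the `h` of ★ `lawsV8_kitFamilyOfRecordW_of_rows`), not the v6 projection `.Routing` of ★ p849502 ∕ ★ p849516՚s `h`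
    F0P3InnerFormClassificationV8.ClassificationKit.Routing (kitFamilyOfRecordW 𝔇W L ι H T hT hdef h2 μ μω hμu hμω) ∧
    JInfNoDegOne (𝔇W L ι H T hT hdef h2 μ μω hμu hμω).jInf ∧ DsInfNoDegOne (𝔇W L ι H T hT hdef h2 μ μω hμu hμω).dsInf ∧
    (kitFamilyOfRecordW 𝔇W L ι H T hT hdef h2 μ μω hμu hμω).XiFamilyFin μω hμu ∧
    (kitFamilyOfRecordW 𝔇W L ι H T hT hdef h2 μ μω hμu hμω).XiUnram ∧
    (kitFamilyOfRecordW 𝔇W L ι H T hT hdef h2 μ μω hμu hμω).EvpConvention)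

include h in
/-- **MEM at the rows of a W-kit family of record** (the W twin of ★ `F0P2oD7alphaMemDockOfRows.mem_packFin_of_rows`): for every (frame, μ), every finite component `σ` of a hol ∕ antihol
cotangent discrete `P` in the ξ-family, and every non-split-or-split finite place `v`, each local constituent class `c` of `σ_v` lies in the kit family՚s finite ξ-packet
`((kitFamilyOfRecordW 𝔇W …).packFin ξ v).members`.  Proof: ★ kit-generic MEM `F0P2oD7alphaMemOfT5.mem_packFin_of_memXiFamily_of_T5` at the W family, fed ★ `isPinned_kitFamilyOfRecordW`
and the v8 family laws ★ `lawsV8_kitFamilyOfRecordW_of_rows 𝔇W h` (whose `h` text is THIS file՚s `h`, token for token — row #9 in the v8 GUARDED routing currency).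
[cite: Rogawski1990, §13.1 Prop. 13.1.3 (d) p. 199; §14.6 p. 242] -/
theorem mem_packFin_of_rowsW :
    ∀ (L : Type) [Field L] [NumberField L] [IsCMField L] (ι : L →+* ℂ) (H : Matrix (Fin 3) (Fin 3) L) (T : GL (Fin 3) ℂ)
      (hT : (T : Matrix (Fin 3) (Fin 3) ℂ)ᴴ * H.map ι * (T : Matrix (Fin 3) (Fin 3) ℂ) = Literature.Geometry.ComplexHyperbolic.BallModel.J)
      (hdef : ∀ τ' : L →+* ℂ, InfinitePlace.mk τ' ≠ InfinitePlace.mk ι → (H.map τ').PosDef)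
      (h2 : 2 ≤ Module.finrank ℚ ↥(maximalRealSubfield L))
      (μ : Measure (adelicGroupData (↥(maximalRealSubfield L)) L (IsCMField.complexConj L) 3 H).automorphicQuotient)
      [(adelicGroupData (↥(maximalRealSubfield L)) L (IsCMField.complexConj L) 3 H).IsAutomorphicMeasure μ]
      (μω : HeckeCharacter L) (hμu : μω.IsUnitary)
      (hμω : ∀ x : Literature.NumberTheory.GaloisRepresentations.ideleGroup ↥(maximalRealSubfield L),
        μω (AdeleRing.ideleBaseChange (↥(maximalRealSubfield L)) L x) = quadraticHeckeCharCM L x)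
      (W : Type) [AddCommGroup W] [Module ℂ W]
      (σ : Representation ℂ (finAdelic (↥(maximalRealSubfield L)) L (IsCMField.complexConj L) 3 H) W),
      σ.IsIrreducible → σ.IsSmooth →
      ∀ (P : DiscreteAutomorphicRep (adelicGroupData (↥(maximalRealSubfield L)) L (IsCMField.complexConj L) 3 H) μ),
        (P.IsHolCotangentAt (cmArchSection L ι H T hT) (cmCompactFactor L ι H T hT) ∨
          P.IsAntiholCotangentAt (cmArchSection L ι H T hT) (cmCompactFactor L ι H T hT)) →
        P.HasFinComponent σ →
      ∀ (ξ : OneDimAutRepH L),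
        MemXiFamily P (transpose_map_cmConjRingHom_eq_of_frame L ι H T hT) (isUnit_det_of_frame L ι H T hT) μω hμu ξ →
      ∀ (v : HeightOneSpectrum (𝓞 ↥(maximalRealSubfield L))) (c : IrrClass ((cmDatum L 3 H).Local v)),
        (IrrClass.comap (localPiEquiv L (IsCMField.complexConj L) 3 H v) c).IsConstituentOf
            (σ.comp (inclPlace (↥(maximalRealSubfield L)) L (IsCMField.complexConj L) 3 H v)) →
        c ∈ ((kitFamilyOfRecordW 𝔇W L ι H T hT hdef h2 μ μω hμu hμω).packFin ξ v).members :=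
  F0P2oD7alphaMemOfT5.mem_packFin_of_memXiFamily_of_T5 (kitFamilyOfRecordW 𝔇W) (isPinned_kitFamilyOfRecordW 𝔇W)
    (lawsV8_kitFamilyOfRecordW_of_rows 𝔇W h)

include h in
open scoped Classical in
/-- **THE W1 NODE `StubD7αMemDockPerMeasureTW1` FROM THE ROWS OF A W-KIT FAMILY AND RECORD DATA SIGNED AT THE FACTOR OF RECORD, WITH (D-b)ᵀˢ-W1** (the W twin of ★ p849502
`F0P2oD7alphaMemDockOfRowsSignedW1.stubD7αMemDockPerMeasureTW1_of_rowsSigned`: same `hrecSW1` TEXT with `kitFamilyOfRecord 𝔇 ↦ kitFamilyOfRecordW 𝔇W` in the (H₄ᵀˢ) packet-identity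
conjunct; same proof bytes, MEM_μ through `mem_packFin_of_rowsW`).  Hypotheses as ★ B2 `stubD7αMemDockPerMeasureT_of_rowsSigned` with (H₈ᵀˢ) ↦ (H₈ᵀˢ-W1)
`piSCompletion_isThetaTypeAtCMTestSignedW1` BY NAME; conclusion the W1 node BY NAME (kit-free).  Print՚s dock ∕ (D-b) [Rogawski1990 Prop. 13.1.3 (d), 13.1.4; GelbartRogawski1991
Lem. 5.1.2, Thm. 5.1.1] RESTRICTED to the weight-one automorphic locus `(HasWeight μ 1, IsAutomorphicOneChar χf)` — the only locus HC_CM instantiates (★ `pkPi_of_tokensW1`).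
[cite: Rogawski1990, §13.1 Prop. 13.1.3 (d), Prop. 13.1.4 p. 199; §4.9 Prop. 4.9.1 (a) p. 55; §14.6 p. 242] [cite: GelbartRogawski1991, Lem. 5.1.2 p. 466; Thm. 5.1.1 p. 465]
[cite: Liu2021, Def. 4.11, Prop. 4.13] -/
theorem stubD7αMemDockPerMeasureTW1_of_rowsSignedW
  (hrecSW1 : ∀ (L : Type) [Field L] [NumberField L] [IsCMField L] (ι : L →+* ℂ) (H : Matrix (Fin 3) (Fin 3) L) (T : GL (Fin 3) ℂ)
    (hT : (T : Matrix (Fin 3) (Fin 3) ℂ)ᴴ * H.map ι * (T : Matrix (Fin 3) (Fin 3) ℂ) = Literature.Geometry.ComplexHyperbolic.BallModel.J)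
    (hdef : ∀ τ' : L →+* ℂ, InfinitePlace.mk τ' ≠ InfinitePlace.mk ι → (H.map τ').PosDef) (h2 : 2 ≤ Module.finrank ℚ ↥(maximalRealSubfield L))
    (μω : HeckeCharacter L) (hμu : μω.IsUnitary)
    (hμω : ∀ x : Literature.NumberTheory.GaloisRepresentations.ideleGroup ↥(maximalRealSubfield L), μω (AdeleRing.ideleBaseChange (↥(maximalRealSubfield L)) L x) = quadraticHeckeCharCM L x)
    (μ : Measure (adelicGroupData (↥(maximalRealSubfield L)) L (IsCMField.complexConj L) 3 H).automorphicQuotient) [(adelicGroupData (↥(maximalRealSubfield L)) L (IsCMField.complexConj L) 3 H).IsAutomorphicMeasure μ],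
    letI : ∀ v : HeightOneSpectrum (𝓞 ↥(maximalRealSubfield L)), MeasurableSpace ((cmDatum L 3 H).Local v) := fun _ => borel _
    letI : ∀ v : HeightOneSpectrum (𝓞 ↥(maximalRealSubfield L)),
        MeasurableSpace ((cmDatum L 2 (Matrix.of fun i j : Fin 2 => if i.val + j.val + 1 = 2 then (1 : L) else 0)).Local v ×
          (cmDatum L 1 (Matrix.of fun i j : Fin 1 => if i.val + j.val + 1 = 1 then (1 : L) else 0)).Local v) := fun _ => borel _
    letI : ∀ (v : HeightOneSpectrum (𝓞 ↥(maximalRealSubfield L)))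
        (a : ((cmDatum L 2 (Matrix.of fun i j : Fin 2 => if i.val + j.val + 1 = 2 then (1 : L) else 0)).Local v ×
          (cmDatum L 1 (Matrix.of fun i j : Fin 1 => if i.val + j.val + 1 = 1 then (1 : L) else 0)).Local v)),
        MeasurableSpace (((cmDatum L 2 (Matrix.of fun i j : Fin 2 => if i.val + j.val + 1 = 2 then (1 : L) else 0)).Local v ×
            (cmDatum L 1 (Matrix.of fun i j : Fin 1 => if i.val + j.val + 1 = 1 then (1 : L) else 0)).Local v) ⧸
          Subgroup.centralizer ({a} : Set ((cmDatum L 2 (Matrix.of fun i j : Fin 2 => if i.val + j.val + 1 = 2 then (1 : L) else 0)).Local v ×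
            (cmDatum L 1 (Matrix.of fun i j : Fin 1 => if i.val + j.val + 1 = 1 then (1 : L) else 0)).Local v))) := fun _ _ => borel _
    letI : ∀ (v : HeightOneSpectrum (𝓞 ↥(maximalRealSubfield L))) (γ : (cmDatum L 3 H).Local v),
        MeasurableSpace ((cmDatum L 3 H).Local v ⧸ Subgroup.centralizer ({γ} : Set ((cmDatum L 3 H).Local v))) := fun _ _ => borel _
    letI : ∀ v : HeightOneSpectrum (𝓞 ↥(maximalRealSubfield L)), MeasurableSpace (Gqs L v ⧸ Subgroup.center (Gqs L v)) := fun _ => borel _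
    ∃ (Δ : ∀ v : HeightOneSpectrum (𝓞 ↥(maximalRealSubfield L)), LocalTransferFactor L H v)
      (mH : ∀ v : HeightOneSpectrum (𝓞 ↥(maximalRealSubfield L)),
    OrbitalMeasureFamily ((cmDatum L 2 (Matrix.of fun i j : Fin 2 => if i.val + j.val + 1 = 2 then (1 : L) else 0)).Local v ×
      (cmDatum L 1 (Matrix.of fun i j : Fin 1 => if i.val + j.val + 1 = 1 then (1 : L) else 0)).Local v))
      (mG : ∀ v : HeightOneSpectrum (𝓞 ↥(maximalRealSubfield L)), OrbitalMeasureFamily ((cmDatum L 3 H).Local v))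
      (νG : ∀ v : HeightOneSpectrum (𝓞 ↥(maximalRealSubfield L)), Measure ((cmDatum L 3 H).Local v))
      (νH : ∀ v : HeightOneSpectrum (𝓞 ↥(maximalRealSubfield L)),
    Measure ((cmDatum L 2 (Matrix.of fun i j : Fin 2 => if i.val + j.val + 1 = 2 then (1 : L) else 0)).Local v ×
      (cmDatum L 1 (Matrix.of fun i j : Fin 1 => if i.val + j.val + 1 = 1 then (1 : L) else 0)).Local v))
      (μZ : ∀ v : HeightOneSpectrum (𝓞 ↥(maximalRealSubfield L)), Measure (Gqs L v ⧸ Subgroup.center (Gqs L v))),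
      -- (H₄ᵀˢ) SHAPE of the kit family's finite packets at non-split places, the identity (13.1.4) for `⟨πⁿ ∘ e, some πˢ⟩` ON TEST FUNCTIONS **SIGNED** by the clause sign
      -- `ε_v(a)` of the SHAPE's own frame multiplier `a` (the node's local form-congruence binder `T` is spelled `Tv` here, the frame's `T : GL (Fin 3) ℂ` being in scope)
      (∀ (ξ : OneDimAutRepH L) (v : HeightOneSpectrum (𝓞 ↥(maximalRealSubfield L))),
          (∀ w : PlacesOver L v, IsCMField.complexConj L • w.1 = w.1) →
          ∃ (Tv : GL (Fin 3) (LocalRing L v)) (a : LocalRing L v) (ha : IsUnit a)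
            (h : formCongr (conjLocal L (IsCMField.complexConj L) v) Tv (H.map (algebraMap L (LocalRing L v))) =
              a • (Matrix.of fun i j : Fin 3 => if i.val + j.val + 1 = 3 then (1 : L) else 0).map (algebraMap L (LocalRing L v)))
            (π2 πn : IrrClass (Gqs L v)) (πs : IrrClass ((cmDatum L 3 H).Local v)),
            KeysCaseTwoLabels L v (μω.semilocalComponent L v) (torusLocalComponent L (IsCMField.complexConj L) v ξ.η)
                (torusLocalComponent L (IsCMField.complexConj L) v ξ.ψ) π2 πn ∧
              π2.IsSquareIntegrable (μZ v) ∧ ¬ πn.IsSquareIntegrable (μZ v) ∧ πs.IsSupercuspidal ∧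
              πs ≠ IrrClass.comap (cmDatumLocalCongr L v Tv ha h).symm πn ∧
              (⟨IrrClass.comap (cmDatumLocalCongr L v Tv ha h).symm πn, some πs⟩ : CMLocalAPacket L H v).CharIdentityAtTest L H v
                (fun c f => (if ∃ z : LocalRing L v, IsUnit z ∧ a = z * conjLocal L (IsCMField.complexConj L) v z then (1 : ℂ) else -1) * c.smoothTrace (νG v) f)
                (ξ.xiLocalChar v) (νH v) (Δ v) (mH v) (mG v) ∧
              (kitFamilyOfRecordW 𝔇W L ι H T hT hdef h2 μ μω hμu hμω).packFin ξ v = ⟨IrrClass.comap (cmDatumLocalCongr L v Tv ha h).symm πn, some πs⟩) ∧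
      -- (H₅) (H₆) Haar measures: `μZ v` and `νG v`
      (∀ v : HeightOneSpectrum (𝓞 ↥(maximalRealSubfield L)), (μZ v).IsHaarMeasure) ∧
      (∀ v : HeightOneSpectrum (𝓞 ↥(maximalRealSubfield L)), (νG v).IsHaarMeasure) ∧
      -- (H₇) `φ ↦ φ^H` exists on `C_c^∞` at every non-split finite place [Rogawski1990 Prop. 4.9.1 (a)], at `Δ`
      (∀ v : HeightOneSpectrum (𝓞 ↥(maximalRealSubfield L)), (∀ w : PlacesOver L v, IsCMField.complexConj L • w.1 = w.1) →
        IsLocalDeltaTransferExists L H v (Δ v) (mH v) (mG v) Literature.NumberTheory.Rogawski1990.IsLocSmooth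
          Literature.NumberTheory.Rogawski1990.IsLocSmooth) ∧
      -- (H₈ᵀˢ-W1) the SIGNED letter (D-b)ᵀˢ RESTRICTED TO THE WEIGHT-ONE AUTOMORPHIC LOCUS, BY NAME, at these data (in-house payable: LH10 ROAD W)
      (∀ {n' : ℕ} (e₁ : Fin 3 × Fin 1 ≃ Fin n') (dV : Fin 3 → L) (hdV : ∀ i, IsCMField.complexConj L (dV i) = dV i) (hdV0 : ∀ i, dV i ≠ 0) (g : GL (Fin 3) L)
          (hg : ((g : Matrix (Fin 3) (Fin 3) L).map (cmConjRingHom L))ᵀ * H * (g : Matrix (Fin 3) (Fin 3) L) = Matrix.diagonal dV) (ξ : OneDimAutRepH L),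
        Literature.NumberTheory.GelbartRogawski1991.piSCompletion_isThetaTypeAtCMTestSignedW1 L H Δ mH mG νH νG ξ μω (fun v => ξ.xiLocalChar v) e₁ dV hdV hdV0 g hg)) :
    F0P2oD7alphaMemDockStatementW1.StubD7αMemDockPerMeasureTW1 := by
  intro L _ _ _ ι H T hT hdef h2 μω hμu hμω μ _
  -- borel σ-algebras, as in the node's `letI`s
  letI : ∀ v : HeightOneSpectrum (𝓞 ↥(maximalRealSubfield L)), MeasurableSpace ((cmDatum L 3 H).Local v) := fun _ => borel _
  letI : ∀ v : HeightOneSpectrum (𝓞 ↥(maximalRealSubfield L)),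
      MeasurableSpace ((cmDatum L 2 (Matrix.of fun i j : Fin 2 => if i.val + j.val + 1 = 2 then (1 : L) else 0)).Local v ×
        (cmDatum L 1 (Matrix.of fun i j : Fin 1 => if i.val + j.val + 1 = 1 then (1 : L) else 0)).Local v) := fun _ => borel _
  letI : ∀ (v : HeightOneSpectrum (𝓞 ↥(maximalRealSubfield L)))
      (a : ((cmDatum L 2 (Matrix.of fun i j : Fin 2 => if i.val + j.val + 1 = 2 then (1 : L) else 0)).Local v ×
        (cmDatum L 1 (Matrix.of fun i j : Fin 1 => if i.val + j.val + 1 = 1 then (1 : L) else 0)).Local v)),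
      MeasurableSpace (((cmDatum L 2 (Matrix.of fun i j : Fin 2 => if i.val + j.val + 1 = 2 then (1 : L) else 0)).Local v ×
          (cmDatum L 1 (Matrix.of fun i j : Fin 1 => if i.val + j.val + 1 = 1 then (1 : L) else 0)).Local v) ⧸
        Subgroup.centralizer ({a} : Set ((cmDatum L 2 (Matrix.of fun i j : Fin 2 => if i.val + j.val + 1 = 2 then (1 : L) else 0)).Local v ×
          (cmDatum L 1 (Matrix.of fun i j : Fin 1 => if i.val + j.val + 1 = 1 then (1 : L) else 0)).Local v))) := fun _ _ => borel _
  letI : ∀ (v : HeightOneSpectrum (𝓞 ↥(maximalRealSubfield L))) (γ : (cmDatum L 3 H).Local v),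
      MeasurableSpace ((cmDatum L 3 H).Local v ⧸ Subgroup.centralizer ({γ} : Set ((cmDatum L 3 H).Local v))) := fun _ _ => borel _
  letI : ∀ v : HeightOneSpectrum (𝓞 ↥(maximalRealSubfield L)), MeasurableSpace (Gqs L v ⧸ Subgroup.center (Gqs L v)) := fun _ => borel _
  obtain ⟨Δ, mH, mG, νG, νH, μZ, hshape, hHaar, hνG, hex, hW⟩ := hrecSW1 L ι H T hT hdef h2 μω hμu hμω μ
  have hH : (H.map (cmConjRingHom L))ᵀ = H := transpose_map_cmConjRingHom_eq_of_frame L ι H T hT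
  refine ⟨fun v => (Δ v).constMul ((formSignAt L (IsCMField.complexConj L) H v : ℤ) : ℂ), mH, mG, νG, νH, fun ξ v => ξ.xiLocalChar v, μZ,
    (kitFamilyOfRecordW 𝔇W L ι H T hT hdef h2 μ μω hμu hμω).packFin, hHaar, hνG, ?_, ?_, ?_⟩
  · -- DOCKᵀ-W1 at `Δ°`: ROAD W (d) junction fed (H₇) and (H₈ᵀˢ-W1)
    intro n' e₁ dV hdV hdV0 g hg ξ
    haveI : ∀ v : HeightOneSpectrum (𝓞 ↥(maximalRealSubfield L)), BorelSpace ((cmDatum L 3 H).Local v) := fun _ => ⟨rfl⟩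
    haveI : ∀ v : HeightOneSpectrum (𝓞 ↥(maximalRealSubfield L)), (νG v).IsHaarMeasure := hνG
    exact F0P2oCharIdentityCompletionUniqueTestW1.cmThetaDockingClausesTestW1_constMul_formSignAt_of_thetaWitnessSignedW1 L H hH
      (isUnit_det_of_frame L ι H T hT) Δ mH mG νH νG ξ μω (fun v => ξ.xiLocalChar v) e₁ dV hdV hdV0 g hg hex (hW e₁ dV hdV hdV0 g hg ξ)
  · -- SHAPE at `Δ°` from the SIGNED SHAPE at `Δ` (B1 `charIdentityAtTest_constMul_iff` along `clauseSign_eq_intCast_formSignAt` at the SHAPE's own frame)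
    intro ξ v hns
    obtain ⟨Tv, a, ha, h', π2, πn, πs, hK, h2sq, hnsq, hsc, hne, hCI, hpack⟩ := hshape ξ v hns
    refine ⟨Tv, a, ha, h', π2, πn, πs, hK, h2sq, hnsq, hsc, hne, ?_, hpack⟩
    dsimp only
    rw [LocalAPacket.charIdentityAtTest_constMul_iff L H v _ (fun c f => c.smoothTrace (νG v) f) (ξ.xiLocalChar v) (νH v) (Δ v) (mH v) (mG v)
      (intCast_formSignAt_mul_self L H v), ← clauseSign_eq_intCast_formSignAt L H hH v hns Tv a ha h']
    exact hCI
  · -- MEM_μ: ★ `mem_packFin_of_rows` at the rows — the packet IS the kit family's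
    intro W _ _ σ hirr hsm _hadm P hP hPσ ξ hmem v _hns c hc
    exact mem_packFin_of_rowsW 𝔇W h L ι H T hT hdef h2 μ μω hμu hμω W σ hirr hsm P hP hPσ ξ hmem v c hc

include h in
/-- **(D7α) «D7αᵀ AT RUNG 0, DRY TERM, SIGNED, W1, W-KIT CURRENCY»: the W1 node AT THE ROWS OF A W-KIT FAMILY OF RECORD (`FrameDataW`, `kitFamilyOfRecordW` — the closer՚s family of
record since AGG ED. 38 «PK-ε») WHOSE ξ-PACKETS ARE THE SCD RECORD AT THE SIGNED-PACKAGE DATUM** (the W twin of ★ p849516 `…SCDSignedW1.stubD7αMemDockPerMeasureTW1_of_rowsSCDSigned`;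
this is the producer the Day-X term of PKΠ v1.16 `stub_D7αMemDockμTW1` must name — see the module docstring).  Per (frame, μ)
the closer supplies `(Δ, mH, mG, νG, νH, μZ)` (`Δ` = the factor of record `Δ‴`), the Keys handle `keys`, the SIGNED Test package `hQS`, the K-side identification (Ξ), Haar ×2, (H₇)
local Δ-transfer existence at non-split places and (H₈ᵀˢ-W1) the SIGNED letter (D-b)ᵀˢ RESTRICTED to the weight-one automorphic locus (`piSCompletion_isThetaTypeAtCMTestSignedW1`,
BY NAME); conclusion the W1 node `StubD7αMemDockPerMeasureTW1` BY NAME.  The SIGNED SHAPE is ★ `shape_xiPacketFamilyOfRecordSCD_of_packageTestSigned` transported along (Ξ); everything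
else is ROAD W (e) `stubD7αMemDockPerMeasureTW1_of_rowsSigned`.
[cite: Rogawski1990, §13.1 Prop. 13.1.3 (d), Prop. 13.1.4 p. 199; §12.2 (2) pp. 173–174; §14.6 p. 242] [cite: GelbartRogawski1991, Lem. 5.1.2 p. 466; Thm. 5.1.1 p. 465]
[cite: Liu2021, Def. 4.11, Prop. 4.13] [cite: LanglandsShelstad1987, §1] -/
theorem stubD7αMemDockPerMeasureTW1_of_rowsSCDSignedW
  (hrecSCDSW1 : ∀ (L : Type) [Field L] [NumberField L] [IsCMField L] (ι : L →+* ℂ) (H : Matrix (Fin 3) (Fin 3) L) (T : GL (Fin 3) ℂ)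
    (hT : (T : Matrix (Fin 3) (Fin 3) ℂ)ᴴ * H.map ι * (T : Matrix (Fin 3) (Fin 3) ℂ) = Literature.Geometry.ComplexHyperbolic.BallModel.J)
    (hdef : ∀ τ' : L →+* ℂ, InfinitePlace.mk τ' ≠ InfinitePlace.mk ι → (H.map τ').PosDef) (h2 : 2 ≤ Module.finrank ℚ ↥(maximalRealSubfield L))
    (μω : HeckeCharacter L) (hμu : μω.IsUnitary)
    (hμω : ∀ x : Literature.NumberTheory.GaloisRepresentations.ideleGroup ↥(maximalRealSubfield L), μω (AdeleRing.ideleBaseChange (↥(maximalRealSubfield L)) L x) = quadraticHeckeCharCM L x)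
    (μ : Measure (adelicGroupData (↥(maximalRealSubfield L)) L (IsCMField.complexConj L) 3 H).automorphicQuotient) [(adelicGroupData (↥(maximalRealSubfield L)) L (IsCMField.complexConj L) 3 H).IsAutomorphicMeasure μ],
    letI : ∀ v : HeightOneSpectrum (𝓞 ↥(maximalRealSubfield L)), MeasurableSpace ((cmDatum L 3 H).Local v) := fun _ => borel _
    letI : ∀ v : HeightOneSpectrum (𝓞 ↥(maximalRealSubfield L)),
        MeasurableSpace ((cmDatum L 2 (Matrix.of fun i j : Fin 2 => if i.val + j.val + 1 = 2 then (1 : L) else 0)).Local v ×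
          (cmDatum L 1 (Matrix.of fun i j : Fin 1 => if i.val + j.val + 1 = 1 then (1 : L) else 0)).Local v) := fun _ => borel _
    letI : ∀ (v : HeightOneSpectrum (𝓞 ↥(maximalRealSubfield L)))
        (a : ((cmDatum L 2 (Matrix.of fun i j : Fin 2 => if i.val + j.val + 1 = 2 then (1 : L) else 0)).Local v ×
          (cmDatum L 1 (Matrix.of fun i j : Fin 1 => if i.val + j.val + 1 = 1 then (1 : L) else 0)).Local v)),
        MeasurableSpace (((cmDatum L 2 (Matrix.of fun i j : Fin 2 => if i.val + j.val + 1 = 2 then (1 : L) else 0)).Local v ×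
            (cmDatum L 1 (Matrix.of fun i j : Fin 1 => if i.val + j.val + 1 = 1 then (1 : L) else 0)).Local v) ⧸
          Subgroup.centralizer ({a} : Set ((cmDatum L 2 (Matrix.of fun i j : Fin 2 => if i.val + j.val + 1 = 2 then (1 : L) else 0)).Local v ×
            (cmDatum L 1 (Matrix.of fun i j : Fin 1 => if i.val + j.val + 1 = 1 then (1 : L) else 0)).Local v))) := fun _ _ => borel _
    letI : ∀ (v : HeightOneSpectrum (𝓞 ↥(maximalRealSubfield L))) (γ : (cmDatum L 3 H).Local v),
        MeasurableSpace ((cmDatum L 3 H).Local v ⧸ Subgroup.centralizer ({γ} : Set ((cmDatum L 3 H).Local v))) := fun _ _ => borel _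
    letI : ∀ v : HeightOneSpectrum (𝓞 ↥(maximalRealSubfield L)), MeasurableSpace (Gqs L v ⧸ Subgroup.center (Gqs L v)) := fun _ => borel _
    ∃ (Δ : ∀ v : HeightOneSpectrum (𝓞 ↥(maximalRealSubfield L)), LocalTransferFactor L H v)
      (mH : ∀ v : HeightOneSpectrum (𝓞 ↥(maximalRealSubfield L)),
    OrbitalMeasureFamily ((cmDatum L 2 (Matrix.of fun i j : Fin 2 => if i.val + j.val + 1 = 2 then (1 : L) else 0)).Local v ×
      (cmDatum L 1 (Matrix.of fun i j : Fin 1 => if i.val + j.val + 1 = 1 then (1 : L) else 0)).Local v))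
      (mG : ∀ v : HeightOneSpectrum (𝓞 ↥(maximalRealSubfield L)), OrbitalMeasureFamily ((cmDatum L 3 H).Local v))
      (νG : ∀ v : HeightOneSpectrum (𝓞 ↥(maximalRealSubfield L)), Measure ((cmDatum L 3 H).Local v))
      (νH : ∀ v : HeightOneSpectrum (𝓞 ↥(maximalRealSubfield L)),
    Measure ((cmDatum L 2 (Matrix.of fun i j : Fin 2 => if i.val + j.val + 1 = 2 then (1 : L) else 0)).Local v ×
      (cmDatum L 1 (Matrix.of fun i j : Fin 1 => if i.val + j.val + 1 = 1 then (1 : L) else 0)).Local v))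
      (μZ : ∀ v : HeightOneSpectrum (𝓞 ↥(maximalRealSubfield L)), Measure (Gqs L v ⧸ Subgroup.center (Gqs L v))),
      -- (K) THE KEYS HANDLE and (Qᵀˢ) THE SIGNED TEST PACKAGE at these data (the closer's rung-0 exports `keys`, `hQS` — edition «QCMT SIGNED»), and
      -- (Ξ) the K-side identification: the kit family's finite ξ-packets ARE the SCD record at the datum read off `hQS` (★ `hSCD_of_cmCharIdentityPackageTestSigned`)
      ∃ (hHaar : ∀ v : HeightOneSpectrum (𝓞 ↥(maximalRealSubfield L)), (μZ v).IsHaarMeasure)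
        (_hνG : ∀ v : HeightOneSpectrum (𝓞 ↥(maximalRealSubfield L)), (νG v).IsHaarMeasure)
        (keys : ∀ (ξ : OneDimAutRepH L) (v : HeightOneSpectrum (𝓞 ↥(maximalRealSubfield L))),
        (∀ w : PlacesOver L v, IsCMField.complexConj L • w.1 = w.1) →
          {p : IrrClass (Gqs L v) × IrrClass (Gqs L v) //
            KeysCaseTwoLabels L v (μω.semilocalComponent L v) (torusLocalComponent L (IsCMField.complexConj L) v ξ.η)
              (torusLocalComponent L (IsCMField.complexConj L) v ξ.ψ) p.1 p.2 ∧
            p.1.IsSquareIntegrable (μZ v) ∧ ¬ p.2.IsSquareIntegrable (μZ v)})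
      (hQS : CMCharIdentityPackageTestSigned L H (transpose_map_cmConjRingHom_eq_of_frame L ι H T hT) (isUnit_det_of_frame L ι H T hT) νH νG μω hμu Δ mH mG),
      (haveI : ∀ v : HeightOneSpectrum (𝓞 ↥(maximalRealSubfield L)), (μZ v).IsHaarMeasure := hHaar
       haveI : ∀ v : HeightOneSpectrum (𝓞 ↥(maximalRealSubfield L)), BorelSpace (Gqs L v ⧸ Subgroup.center (Gqs L v)) := fun _ => ⟨rfl⟩
       (kitFamilyOfRecordW 𝔇W L ι H T hT hdef h2 μ μω hμu hμω).packFin =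
        F0P3XiPacketFamilyOfRecordSCD.xiPacketFamilyOfRecordSCD L H (transpose_map_cmConjRingHom_eq_of_frame L ι H T hT) (isUnit_det_of_frame L ι H T hT)
          μω hμu μZ keys
          (F0P3XiPacketFamilyOfRecordSCD.hSCD_of_cmCharIdentityPackageTestSigned L H (transpose_map_cmConjRingHom_eq_of_frame L ι H T hT)
            (isUnit_det_of_frame L ι H T hT) μω hμu Δ mH mG νG νH μZ hQS)) ∧
      -- (H₇) `φ ↦ φ^H` exists on `C_c^∞` at every non-split finite place [Rogawski1990 Prop. 4.9.1 (a)] (the N6 #102 currency), at `Δ`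
      (∀ v : HeightOneSpectrum (𝓞 ↥(maximalRealSubfield L)), (∀ w : PlacesOver L v, IsCMField.complexConj L • w.1 = w.1) →
        IsLocalDeltaTransferExists L H v (Δ v) (mH v) (mG v) Literature.NumberTheory.Rogawski1990.IsLocSmooth
          Literature.NumberTheory.Rogawski1990.IsLocSmooth) ∧
      -- (H₈ᵀˢ-W1) the SIGNED letter (D-b)ᵀˢ RESTRICTED TO THE WEIGHT-ONE AUTOMORPHIC LOCUS, BY NAME, at these data (in-house payable: LH10 ROAD W)
      (∀ {n' : ℕ} (e₁ : Fin 3 × Fin 1 ≃ Fin n') (dV : Fin 3 → L) (hdV : ∀ i, IsCMField.complexConj L (dV i) = dV i) (hdV0 : ∀ i, dV i ≠ 0) (g : GL (Fin 3) L)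
          (hg : ((g : Matrix (Fin 3) (Fin 3) L).map (cmConjRingHom L))ᵀ * H * (g : Matrix (Fin 3) (Fin 3) L) = Matrix.diagonal dV) (ξ : OneDimAutRepH L),
        Literature.NumberTheory.GelbartRogawski1991.piSCompletion_isThetaTypeAtCMTestSignedW1 L H Δ mH mG νH νG ξ μω (fun v => ξ.xiLocalChar v) e₁ dV hdV hdV0 g hg)) :
    F0P2oD7alphaMemDockStatementW1.StubD7αMemDockPerMeasureTW1 := by
  refine stubD7αMemDockPerMeasureTW1_of_rowsSignedW 𝔇W h ?_
  intro L _ _ _ ι H T hT hdef h2 μω hμu hμω μ _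
  obtain ⟨Δ, mH, mG, νG, νH, μZ, hHaar, hνG, keys, hQS, hpk, hex, hW⟩ := hrecSCDSW1 L ι H T hT hdef h2 μω hμu hμω μ
  refine ⟨Δ, mH, mG, νG, νH, μZ, ?_, hHaar, hνG, hex, hW⟩
  -- SIGNED SHAPE at the SCD record (signed-package datum), transported along the K-side identification (Ξ); borel σ-algebras as in the node's `letI`s
  intro ξ v hns
  letI : ∀ v : HeightOneSpectrum (𝓞 ↥(maximalRealSubfield L)), MeasurableSpace ((cmDatum L 3 H).Local v) := fun _ => borel _
  letI : ∀ v : HeightOneSpectrum (𝓞 ↥(maximalRealSubfield L)),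
      MeasurableSpace ((cmDatum L 2 (Matrix.of fun i j : Fin 2 => if i.val + j.val + 1 = 2 then (1 : L) else 0)).Local v ×
        (cmDatum L 1 (Matrix.of fun i j : Fin 1 => if i.val + j.val + 1 = 1 then (1 : L) else 0)).Local v) := fun _ => borel _
  letI : ∀ (v : HeightOneSpectrum (𝓞 ↥(maximalRealSubfield L)))
      (a : ((cmDatum L 2 (Matrix.of fun i j : Fin 2 => if i.val + j.val + 1 = 2 then (1 : L) else 0)).Local v ×
        (cmDatum L 1 (Matrix.of fun i j : Fin 1 => if i.val + j.val + 1 = 1 then (1 : L) else 0)).Local v)),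
      MeasurableSpace (((cmDatum L 2 (Matrix.of fun i j : Fin 2 => if i.val + j.val + 1 = 2 then (1 : L) else 0)).Local v ×
          (cmDatum L 1 (Matrix.of fun i j : Fin 1 => if i.val + j.val + 1 = 1 then (1 : L) else 0)).Local v) ⧸
        Subgroup.centralizer ({a} : Set ((cmDatum L 2 (Matrix.of fun i j : Fin 2 => if i.val + j.val + 1 = 2 then (1 : L) else 0)).Local v ×
          (cmDatum L 1 (Matrix.of fun i j : Fin 1 => if i.val + j.val + 1 = 1 then (1 : L) else 0)).Local v))) := fun _ _ => borel _
  letI : ∀ (v : HeightOneSpectrum (𝓞 ↥(maximalRealSubfield L))) (γ : (cmDatum L 3 H).Local v),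
      MeasurableSpace ((cmDatum L 3 H).Local v ⧸ Subgroup.centralizer ({γ} : Set ((cmDatum L 3 H).Local v))) := fun _ _ => borel _
  letI : ∀ v : HeightOneSpectrum (𝓞 ↥(maximalRealSubfield L)), MeasurableSpace (Gqs L v ⧸ Subgroup.center (Gqs L v)) := fun _ => borel _
  haveI : ∀ v : HeightOneSpectrum (𝓞 ↥(maximalRealSubfield L)), BorelSpace (Gqs L v ⧸ Subgroup.center (Gqs L v)) := fun _ => ⟨rfl⟩
  haveI : ∀ v : HeightOneSpectrum (𝓞 ↥(maximalRealSubfield L)), (μZ v).IsHaarMeasure := hHaar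
  obtain ⟨Tv, a, ha, hc, π2, πn, πs, hK, hs2, hn, hsc, hne, hId, hP⟩ :=
    F0P2oD7alphaShapeOfRecordSCDSigned.shape_xiPacketFamilyOfRecordSCD_of_packageTestSigned L H (transpose_map_cmConjRingHom_eq_of_frame L ι H T hT)
      (isUnit_det_of_frame L ι H T hT) μω hμu Δ mH mG νG νH μZ keys hQS ξ v hns
  exact ⟨Tv, a, ha, hc, π2, πn, πs, hK, hs2, hn, hsc, hne, hId, by rw [hpk]; exact hP⟩

end PerMeasureSCDSW1W

end Summit.HodgeConjecture.HodgeConjecture.Cruxes.H413.F0P2oD7alphaMemDockOfRowsSCDSignedW1W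

end
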